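import Literature.Computability.AlgebraicComplexity.FSV18SuccinctGenerators
import HarnessLib

/-!
# The shift trick of [ASSS16, §4] as a GENERATOR statement for the succinct SV block
# (towards FSV Cor. 49 without FSV Thm. 48's unbounded top fan-in) — val-lit p1 g3

Sources. [ASSS16] = Agrawal–Saha–Saptharishi–Saxena, arXiv:1111.0582, §4 ¶1 (held
`paper:arxiv-1111.0582` p0009:L3–L22): "if `C(x_1, …, x_n)` is non-constant and nonzero, then
there is an `i` such that `C̃ := C(x_1, ⋯, x_i + 1, ⋯, x_n) − C(x_1, ⋯, x_n) ≠ 0` … `C̃` has top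
fanin at most `2k` … Form a new set `ℋ ⊇ ℋ̃` by including points `(α_1, …, α_i + 1, …, α_n)` …
`ℋ` is a hitting-set for `𝒞`." [ForbesShpilkaVolk2018] = FSV, ToC 14(18), Construction 25 / 29
and Fact 27 (additivity of the succinct Shpilka–Volkovich generator; tree `svGenCoeff`,
`ssvGenCoeff_add`), Cor. 49.

Why (val-lit memo HOME/np/p1g3-THM48-provenance-and-plan.md §3): FSV Thm. 48 as typed asserts the
generator property for ALL depth-`D` occur-`k` formulas with an ABSTRACT sparse-hitting block `Φ`,
which [ASSS16] prove only for top fan-in `≤ k`; their remedy for general top fan-in is the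
hitting-SET shift above. For the CONCRETE `Φ` of Cor. 49 — the shifted succinct SV generator — the
shift is itself a specialisation of the generator: one extra SV block, evaluated at
`y = c`, `z = 𝟙_{supp m₀}`, adds `c · e_{m₀}` to the output (this file,
`bind₁_svGenCoeff_succ_lastBlock`). Hence (`isHittingSetGenerator_svGenCoeff_succ_of_shift`): if a
map `G ⊕ G^{SV'}_{n,K}` is a hitting-set generator for a class `𝒞'` containing, for every
non-constant member `C` of `𝒞`, some non-zero unit difference `C(X + e_{m₀}) − C(X)`, then
`G ⊕ G^{SV'}_{n,K+1}` is a hitting-set generator for `𝒞`. Theorems only; no definitions, no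
named facts; the class-closure hypothesis is explicit (for occur-`k` formulas it is [ASSS16]'s
"`C̃` … of depth-`(D+1)` occur-`2k` … size at most `s² + s`", to be supplied by the formula-model
work of the plan).

Honest framing: generator bookkeeping for the N1 row's last conjunct (occur-`k`); `VP ≠ VNP` is
NOT proved and nothing here is progress on it.
-/

noncomputable section

namespace Literature.Computability.AlgebraicComplexity

open MvPolynomial Finset Literature.Barriers.ValiantsHypothesis

variable {F : Type*} [Field F] {n : ℕ}

/-- **Shifting one coordinate commutes with substitution:** substituting `G` into
`D(X_{m₀} ↦ X_{m₀} + c)` is substituting `G + c·e_{m₀}` into `D`. [folklore] -/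
private theorem bind₁_aeval_shift {σ τ : Type*} [DecidableEq σ] (G : σ → MvPolynomial τ F)
    (m₀ : σ) (c : F) (D : MvPolynomial σ F) :
    bind₁ G (aeval (fun m : σ => if m = m₀ then X m + C c else (X m : MvPolynomial σ F)) D) =
      bind₁ (fun m => if m = m₀ then G m + C c else G m) D := by
  rw [← aeval_eq_bind₁, ← aeval_eq_bind₁, comp_aeval_apply]
  refine congrArg (fun f => aeval f D) (funext fun m => ?_)
  by_cases hm : m = m₀
  · simp [hm]
  · simp [hm]

/-- **One SV block realises a scaled unit vector** ([ASSS16]'s shift point inside the generator):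
specialising the LAST block of `G^{SV'}_{n,K+1}` (tree `svGenCoeff F n (K+1)`, FSV Constructions
25/29) at `y_K = c`, `z_{K,i} = 𝟙[i ∈ supp m₀]` and keeping the first `K` blocks gives
`G^{SV'}_{n,K} + c · e_{m₀}` on the multilinear coordinates ("`Q^{SSV}_{n,k}(y,z,x) = Σ y_i P(z_i,x)`,
`P(z,x) = ∏ (z_i x_i + 1 − z_i)`": at a `0/1` seed `P` is one monomial).
[cite: ForbesShpilkaVolk2018, Constructions 25 and 29 with Fact 27 (seq.) = ToC 5.1, 5.5, 5.3; AgrawalEtAl2011, §4 (¶1, the shift `α + e_i`)]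
locator: paper:arxiv-1701.05328 p0018.txt:L5–L21; paper:arxiv-1111.0582 p0009.txt:L3–L22 -/
theorem bind₁_svGenCoeff_succ_lastBlock (K : ℕ) (c : F) {m₀ m : Fin n →₀ ℕ}
    (hm₀ : m₀ ∈ multilinearMonomials n) (hm : m ∈ multilinearMonomials n) :
    bind₁ (Sum.elim
        (fun j : Fin (K + 1) => Fin.lastCases (C c) (fun j' => X (Sum.inl j')) j)
        (fun p : Fin (K + 1) × Fin n => Fin.lastCases (C (if m₀ p.2 = 0 then 0 else 1))
          (fun j' => X (Sum.inr (j', p.2))) p.1) :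
        Fin (K + 1) ⊕ (Fin (K + 1) × Fin n) → MvPolynomial (Fin K ⊕ (Fin K × Fin n)) F)
      (svGenCoeff F n (K + 1) m) =
      svGenCoeff F n K m + C (if m = m₀ then c else 0) := by
  classical
  unfold svGenCoeff
  rw [map_add, map_one, map_sum, Fin.sum_univ_castSucc, add_right_comm]
  congr 1
  · congr 1
    refine Finset.sum_congr rfl fun j _ => ?_
    rw [map_mul, bind₁_X_right, Sum.elim_inl, Fin.lastCases_castSucc, map_prod]
    congr 1
    refine Finset.prod_congr rfl fun i _ => ?_
    split_ifs with h
    · rw [map_sub, map_one, bind₁_X_right, Sum.elim_inr, Fin.lastCases_castSucc]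
    · rw [bind₁_X_right, Sum.elim_inr, Fin.lastCases_castSucc]
  · -- the last block's product is the indicator of `supp m = supp m₀`
    have hfac : ∀ i : Fin n, bind₁ (Sum.elim
        (fun j : Fin (K + 1) => Fin.lastCases (C c) (fun j' => X (Sum.inl j')) j)
        (fun p : Fin (K + 1) × Fin n => Fin.lastCases (C (if m₀ p.2 = 0 then 0 else 1))
          (fun j' => X (Sum.inr (j', p.2))) p.1) :
        Fin (K + 1) ⊕ (Fin (K + 1) × Fin n) → MvPolynomial (Fin K ⊕ (Fin K × Fin n)) F)
        (if m i = 0 then 1 - X (Sum.inr (Fin.last K, i)) else X (Sum.inr (Fin.last K, i))) =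
        C (if (m i = 0 ↔ m₀ i = 0) then (1 : F) else 0) := by
      intro i
      by_cases h : m i = 0 <;> by_cases h₀ : m₀ i = 0 <;>
        simp [h, h₀, bind₁_X_right, Fin.lastCases_last]
    rw [map_mul, bind₁_X_right, Sum.elim_inl, Fin.lastCases_last, map_prod]
    simp_rw [hfac]
    rw [← map_prod, ← map_mul]
    congr 1
    by_cases hmm : m = m₀
    · subst hmm
      simp
    · rw [if_neg hmm]
      -- some coordinate distinguishes the two multilinear exponent vectors
      obtain ⟨i, hi⟩ : ∃ i, ¬ (m i = 0 ↔ m₀ i = 0) := by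
        by_contra hall
        push Not at hall
        apply hmm
        ext i
        have h1 := hm i
        have h2 := hm₀ i
        have h3 := hall i
        omega
      rw [Finset.prod_eq_zero (Finset.mem_univ i) (by rw [if_neg hi]), mul_zero]

/-- **[ASSS16]'s shift trick, generator form, for the succinct SV block:** let `Ψ_K = G ⊕ G^{SV'}_{n,K}`
(`G` any map on disjoint seeds — the Vandermonde blocks of FSV Construction 46). If `Ψ_K` is a
hitting-set generator for a class `𝒞'` such that every non-zero, non-constant `C ∈ 𝒞` has a
non-zero unit difference `C(X + e_{m₀}) − C(X) ∈ 𝒞'` (printed: "`C̃ := C(…, x_i + 1, …) − C ≠ 0` …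
belongs to the class `𝒞̃`"), then `Ψ_{K+1}` is a hitting-set generator for `𝒞` (printed, for
hitting SETS: "`ℋ ⊇ ℋ̃` by including points `α + e_i` … is a hitting-set for `𝒞`"; here the extra
SV block supplies `+ c·e_{m₀}`, `bind₁_svGenCoeff_succ_lastBlock`).
[cite: AgrawalEtAl2011, §4 (¶1); ForbesShpilkaVolk2018, Fact 27 and Cor. 49 (seq.) = ToC Fact 5.3, Cor. 5.25]
locator: paper:arxiv-1111.0582 p0009.txt:L3–L22; paper:arxiv-1701.05328 p0021.txt:L41–L55 -/
theorem isHittingSetGenerator_svGenCoeff_succ_of_shift {τ : Type*} (K : ℕ)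
    (G : multilinearMonomials n → MvPolynomial τ F)
    (𝒞 𝒞' : Set (MvPolynomial (multilinearMonomials n) F))
    (hshift : ∀ C₀ ∈ 𝒞, C₀ ≠ 0 → (∃ a : F, C₀ = C a) ∨
      ∃ m₀ : multilinearMonomials n,
        aeval (fun m : multilinearMonomials n =>
            if m = m₀ then X m + C 1 else (X m : MvPolynomial (multilinearMonomials n) F)) C₀ - C₀ ∈ 𝒞' ∧
        aeval (fun m : multilinearMonomials n =>
            if m = m₀ then X m + C 1 else (X m : MvPolynomial (multilinearMonomials n) F)) C₀ - C₀ ≠ 0)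
    (hgen : IsHittingSetGenerator 𝒞'
      (fun m : multilinearMonomials n =>
        rename Sum.inl (G m) + rename Sum.inr (svGenCoeff F n K (m : Fin n →₀ ℕ)))) :
    IsHittingSetGenerator 𝒞
      (fun m : multilinearMonomials n =>
        rename Sum.inl (G m) + rename Sum.inr (svGenCoeff F n (K + 1) (m : Fin n →₀ ℕ))) := by
  classical
  intro C₀ hC₀ hC₀0 hzero
  rcases hshift C₀ hC₀ hC₀0 with ⟨a, rfl⟩ | ⟨m₀, hmem, hne⟩
  · -- constants are untouched by any substitution
    rw [bind₁_C_right, C_eq_zero] at hzero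
    exact hC₀0 (by rw [hzero, C_0])
  -- specialise the last SV block at `y = c`, `z = 𝟙_{supp m₀}` (and keep everything else)
  have key : ∀ c : F, bind₁ (fun m : multilinearMonomials n =>
      rename Sum.inl (G m) + rename Sum.inr (svGenCoeff F n K (m : Fin n →₀ ℕ)))
      (aeval (fun m : multilinearMonomials n =>
        if m = m₀ then X m + C c else (X m : MvPolynomial (multilinearMonomials n) F)) C₀) = 0 := by
    intro c
    -- the seed substitution
    let θ : τ ⊕ (Fin (K + 1) ⊕ (Fin (K + 1) × Fin n)) →
        MvPolynomial (τ ⊕ (Fin K ⊕ (Fin K × Fin n))) F :=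
      Sum.elim (fun t => X (Sum.inl t)) fun s => rename Sum.inr
        ((Sum.elim
          (fun j : Fin (K + 1) => Fin.lastCases (C c) (fun j' => X (Sum.inl j')) j)
          (fun p : Fin (K + 1) × Fin n => Fin.lastCases (C (if (m₀ : Fin n →₀ ℕ) p.2 = 0 then 0 else 1))
            (fun j' => X (Sum.inr (j', p.2))) p.1) :
          Fin (K + 1) ⊕ (Fin (K + 1) × Fin n) → MvPolynomial (Fin K ⊕ (Fin K × Fin n)) F) s)
    have hθ : ∀ m : multilinearMonomials n, bind₁ θ
        (rename Sum.inl (G m) + rename Sum.inr (svGenCoeff F n (K + 1) (m : Fin n →₀ ℕ))) =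
        (rename Sum.inl (G m) + rename Sum.inr (svGenCoeff F n K (m : Fin n →₀ ℕ))) +
          C (if m = m₀ then c else 0) := by
      intro m
      rw [map_add, bind₁_rename, bind₁_rename]
      have hl : θ ∘ Sum.inl = fun t => X (Sum.inl t) := rfl
      have hr : θ ∘ Sum.inr = fun s => rename Sum.inr ((Sum.elim
          (fun j : Fin (K + 1) => Fin.lastCases (C c) (fun j' => X (Sum.inl j')) j)
          (fun p : Fin (K + 1) × Fin n => Fin.lastCases (C (if (m₀ : Fin n →₀ ℕ) p.2 = 0 then 0 else 1))
            (fun j' => X (Sum.inr (j', p.2))) p.1) :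
          Fin (K + 1) ⊕ (Fin (K + 1) × Fin n) → MvPolynomial (Fin K ⊕ (Fin K × Fin n)) F) s) := rfl
      rw [hl, hr, ← rename_bind₁, bind₁_svGenCoeff_succ_lastBlock K c m₀.2 m.2, map_add, rename_C,
        add_assoc]
      congr 1
      · have hb : (bind₁ (fun t : τ => (X (Sum.inl t) : MvPolynomial (τ ⊕ (Fin K ⊕ (Fin K × Fin n))) F))) =
            rename Sum.inl := by
          refine MvPolynomial.algHom_ext fun t => ?_
          rw [bind₁_X_right, rename_X]
        rw [hb]
      · congr 2
        by_cases h : m = m₀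
        · rw [if_pos h, if_pos (congrArg Subtype.val h)]
        · rw [if_neg h, if_neg (fun h' => h (Subtype.ext h'))]
    have h := congrArg (bind₁ θ) hzero
    rw [map_zero, bind₁_bind₁] at h
    rw [bind₁_aeval_shift]
    have hfun : (fun m : multilinearMonomials n => bind₁ θ
        (rename Sum.inl (G m) + rename Sum.inr (svGenCoeff F n (K + 1) (m : Fin n →₀ ℕ)))) =
        fun m => if m = m₀ then
          (rename Sum.inl (G m) + rename Sum.inr (svGenCoeff F n K (m : Fin n →₀ ℕ))) + C c
          else rename Sum.inl (G m) + rename Sum.inr (svGenCoeff F n K (m : Fin n →₀ ℕ)) := by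
      funext m
      rw [hθ]
      by_cases h : m = m₀
      · rw [if_pos h, if_pos h]
      · rw [if_neg h, if_neg h, C_0, add_zero]
    rw [hfun] at h
    exact h
  -- `c = 1` and `c = 0`: the unit difference is killed by `Ψ_K`, contradicting `hgen`
  have h1 := key 1
  have h0 := key 0
  have h0' : bind₁ (fun m : multilinearMonomials n =>
      rename Sum.inl (G m) + rename Sum.inr (svGenCoeff F n K (m : Fin n →₀ ℕ))) C₀ = 0 := by
    have e : aeval (fun m : multilinearMonomials n =>
        if m = m₀ then X m + C (0 : F) else (X m : MvPolynomial (multilinearMonomials n) F)) C₀ = C₀ := by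
      have : (fun m : multilinearMonomials n =>
          if m = m₀ then X m + C (0 : F) else (X m : MvPolynomial (multilinearMonomials n) F)) = X := by
        funext m
        split_ifs <;> simp
      rw [this, aeval_X_left_apply]
    rw [e] at h0
    exact h0
  refine hgen _ hmem hne ?_
  rw [map_sub, h1, h0', sub_zero]

end Literature.Computability.AlgebraicComplexity

end
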